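/-
Copyright (c) 2026 the pub-hodgecm-mathlib formalisation cell (harness21).  Prover seat hodgecm-mathlib-F0P3a-p08 (g20): road «S3-ram» (LEAD F0P3a-plan (g13);
owner F0P3a-p06 (g15)), (T2) G-side organ (Cnt2′) (chair F0P3a-p07 (g14) RULINGS (9)(b)∕(10)(3)), organ (z6) «FIX-FINITE, BLOCK LITERAL»; 2026-09-02.
-/
import Literature.NumberTheory.Automorphic.UnitaryLatticeTreeTubeCone              -- ★ p848446 (F0P2-p01 (g16)): `scaleLattice_axisVertex_le`; brings ★ TubeAxisVertex p848332 (`exists_axisVertex_eq_latt_endoGL`), ★ TubeCoordinate p848197 (`exists_tubeCoordinate`, `mapGL_axisVertex_eq_of_mapGL_eq`)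
import Literature.NumberTheory.Automorphic.UnitaryLatticeTreeAxisCountTransport    -- ★ p847852 (F0P3a-p07 (g14)): `latt_endoGL_one_eq_iff`; brings ★ (z1-b) `mapGL_endoGL_latt_endoGL_eq_iff`
import Literature.NumberTheory.Automorphic.UnitaryLatticeTreeIntervalFinite        -- ★ (B-p14): `finite_setOf_mapGL_scaleLattice_le_and_le` (translated lattice intervals are finite)
import Literature.NumberTheory.Automorphic.UnitaryLatticeTreeFixedVertex           -- ★ `scaleLattice_scaleLattice`, `scaleLattice_mono`, `scaleLattice_le_self_of_v_le_one`
import Literature.Combinatorics.SimpleGraph.TreeDescendantPartition                -- ★ G1 p847239 (F0P2-p02): `exists_rooted_parent`, `parentClosed_fixedPoints`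
import HarnessLib

/-!
# The lattice graph of a hermitian space — THE FIXED SET OF A BLOCK ELEMENT `ι(γ₂, u)` IS FINITE, given finitely many `γ₂`-fixed self-dual `W`-lattices and a tube bound
# (Bruhat–Tits 1972 §10; Kottwitz 1986 §3; Serre, *Trees* I.2.3, II.1.1)

Topic `NumberTheory/Automorphic`; namespace `Literature.NumberTheory.Automorphic.UnitaryLatticeTree`.  THEOREMS ONLY (no definition, no instance, no notation, no named fact,
no `sorry`); kernel lane `--supports stmt-HodgeConjecture-24833`; datum-free (`K` with `Valued K ℤᵐ⁰`).  Cell `pub/hodgecm-mathlib` (D-0151), crux H413; road «S3-ram»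
(Literature seeding, count-neutral); (T2) G-side organ (Cnt2′) (chair F0P3a-p07 (g14)), organ **(z6) «FIX-FINITE, BLOCK LITERAL»** (RULING (9)(b): the `hFfin` input of
F0P2-p02 (g14)'s route-B head `strataCount_J₀_block` has no type-(2) supplier — the type-(1) supplier ★ J4a `finite_setOf_latticeGraphIso_diagonal_eq` is a K-eigenframe
argument, and `ι(γ₂, u)` has no K-eigenframe).  BLOCK CURRENCY of ★ `UnitaryLatticeTreeTubeCoordinate` ∕ `…TubeAxisVertex` ∕ `…TubeCone` (F0P2-p01 (g16)) and ★ (z1-a∕b∕d)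
(F0P3a-p07 (g14)): `H = !![H₂ 0 0, 0, H₂ 0 1; 0, h, 0; H₂ 1 0, 0, H₂ 1 1]` (`H₂` σ-hermitian with `det H₂` a unit… `IsUnit H₂.det`, `|h| = 1`, `σh = h`), `Γ = ι(γ₂, u) = endoGL (γ₂, u)`.

THE MATHEMATICS.  Let `M` be a SELF-DUAL lattice with `Γ·M = M`; it has a tube coordinate `b` (`c·e₁ ∈ M ⟺ |c| ≤ |ϖ|^b`, ★ `exists_tubeCoordinate`) and an AXIS VERTEX
`A(M) = (M ∩ W) + ϖ^b·M + 𝒪e₁ = latt ι(g₂, 1)` with `latt g₂` self-dual for `H₂` (★ `exists_axisVertex_eq_latt_endoGL`), fixed by `Γ` (★ `mapGL_axisVertex_eq_of_mapGL_eq`), so that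
`γ₂·latt g₂ = latt g₂` (★ (z1-b) `mapGL_endoGL_latt_endoGL_eq_iff`): the `W`-lattice `latt g₂` runs through the FINITE set `hWfin` of `γ₂`-fixed self-dual `W`-lattices (the
(B-i) `j = 0` count at the CM place).  Moreover **`ϖ^b·A(M) ≤ M ≤ ϖ^{−b}·A(M)`** (★ `scaleLattice_axisVertex_le`; `ϖ^b·M ≤ A(M)` by definition), so with the TUBE BOUND
`b ≤ R` (F0P2-p01 (g16), from ★ (c3-iv)) every fixed self-dual `M` lies in one of finitely many translated intervals `[ϖ^R·latt ι(g₂,1), ϖ^{−R}·latt ι(g₂,1)]`, each finite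
(★ `finite_setOf_mapGL_scaleLattice_le_and_le`).  §2 passes from self-dual lattices to ALL fixed vertices of the (tree) lattice graph: by alternation a fixed non-self-dual vertex
is adjacent to a fixed self-dual one (its rooted parent, ★ G1 `parentClosed_fixedPoints`), unless the fixed set is a single vertex.

* §1 `le_scaleLattice_inv_pow_axisVertex` (`M ≤ ϖ^{−b}·A(M)`), **`finite_setOf_selfDual_mapGL_endoGL_eq`** (THM A).
* §2 **`finite_setOf_latticeGraphIso_eq_of_selfDual_finite`** (generic: tree + alternation + locally finite + finitely many fixed self-dual vertices ⇒ finite fixed set),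
  **`finite_setOf_latticeGraphIso_endoGL_eq`** (THM B, the `hFfin` shape).

HONEST LABEL: HC_CM is proved only modulo the 2 remaining named inputs (hLiu418 24832, h413 24833) until rung 0 closes; nothing printed is asserted here (elementary lattice
bookkeeping); «S3-ram» has no books consequence.

## References
* [BruhatTits1972] F. Bruhat, J. Tits, *Groupes réductifs sur un corps local I*, Publ. Math. IHÉS 41 (1972), §10 (lattice models; bounded fixed sets of elliptic elements).
* [Kottwitz1986] R. E. Kottwitz, *Base change for unit elements of Hecke algebras*, Compositio Math. 60 (1986), §3 (finiteness of the fixed lattice set).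
* [Serre1980Trees] J.-P. Serre, *Trees* (1980), Ch. I §2.3, §6.4 (fixed points of automorphisms), Ch. II §1.1 (lattices between `ϖ^aL` and `ϖ^bL`).
-/

set_option autoImplicit false

noncomputable section

open scoped Valued WithZero Matrix MatrixGroups

namespace Literature.NumberTheory.Automorphic.UnitaryLatticeTree

open Literature.NumberTheory.Automorphic Literature.NumberTheory.Automorphic.HermitianLattice Literature.NumberTheory.Rogawski1990
open Literature.Combinatorics.SimpleGraph.TreeLayers

variable {K : Type*} [Field K] [Valued K ℤᵐ⁰]

/-! ## §1 Fixed self-dual lattices of a block element: finitely many -/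

/-- **`M ≤ ϖ^{−b}·A(M)`**: the axis vertex `A(M) = (M ∩ W) ⊔ ϖ^b·M ⊔ 𝒪e₁` contains `ϖ^b·M`. [cite: BruhatTits1972, §10] [cite: Serre1980Trees, II.1.1] -/
theorem le_scaleLattice_inv_pow_axisVertex {ϖ : K} (hϖ0 : ϖ ≠ 0) (M : Submodule 𝒪[K] (Fin 3 → K)) (b : ℕ) :
    M ≤ scaleLattice ((ϖ ^ b)⁻¹) (M ⊓ LinearMap.ker ((LinearMap.proj (1 : Fin 3) : (Fin 3 → K) →ₗ[K] K).restrictScalars 𝒪[K]) ⊔ scaleLattice (ϖ ^ b) M ⊔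
        Submodule.span 𝒪[K] {(Pi.single 1 1 : Fin 3 → K)}) := by
  intro x hx
  rw [mem_scaleLattice_iff (inv_ne_zero (pow_ne_zero b hϖ0)), inv_inv]
  refine Submodule.mem_sup_left (Submodule.mem_sup_right ?_)
  rw [mem_scaleLattice_iff (pow_ne_zero b hϖ0), inv_smul_smul₀ (pow_ne_zero b hϖ0)]
  exact hx

/-- `g·(c·𝒪³) = c·latt g`. [cite: Serre1980Trees, II.1.1] -/
theorem mapGL_scaleLattice_stdLattice {N : ℕ} (g : GL (Fin N) K) (c : K) :
    mapGL g (scaleLattice c (stdLattice K N)) = scaleLattice c (latt (g : Matrix (Fin N) (Fin N) K)) := by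
  rw [mapGL_scaleLattice, ← latt_one, ← Units.val_one, mapGL_latt, mul_one]

set_option maxHeartbeats 800000 in
-- budget only: statement-heavy block tokens.
/-- **THM A — THE `Γ`-FIXED SELF-DUAL LATTICES OF A BLOCK ELEMENT ARE FINITELY MANY**, given (i) finitely many `γ₂`-fixed self-dual `W`-lattices (`hWfin`) and (ii) a TUBE
BOUND `b ≤ R` on the fixed self-dual lattices (`htube`): every such `M` lies in `[ϖ^R·latt ι(g₂,1), ϖ^{−R}·latt ι(g₂,1)]` for the axis vertex `latt ι(g₂,1) = A(M)`,
`latt g₂ ∈ hWfin`. [cite: BruhatTits1972, §10] [cite: Kottwitz1986, §3] [cite: Serre1980Trees, II.1.1] -/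
theorem finite_setOf_selfDual_mapGL_endoGL_eq [IsPrincipalIdealRing 𝒪[K]] [Finite 𝓀[K]] (σ : K →+* K) (hσ : ∀ a, σ (σ a) = a)
    (hvσ : ∀ a, Valued.v (σ a) = Valued.v a) {ϖ : K} (hϖ : Valued.v ϖ = WithZero.exp (-1 : ℤ))
    {H₂ : Matrix (Fin 2) (Fin 2) K} (hH₂ : IsUnit H₂.det) (hH₂σ : (H₂.map σ)ᵀ = H₂) {h : K} (hh : Valued.v h = 1) (hhσ : σ h = h)
    (γ₂ : GL (Fin 2) K) (u : GL (Fin 1) K)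
    (hWfin : {B : Submodule 𝒪[K] (Fin 2 → K) | IsSelfDualLattice σ ϖ H₂ B ∧ mapGL γ₂ B = B}.Finite) (R : ℕ)
    (htube : ∀ M : Submodule 𝒪[K] (Fin 3 → K), IsSelfDualLattice σ ϖ (!![H₂ 0 0, 0, H₂ 0 1; 0, h, 0; H₂ 1 0, 0, H₂ 1 1] : Matrix (Fin 3) (Fin 3) K) M →
      mapGL (endoGL (γ₂, u)) M = M → ∀ b : ℕ, (∀ c : K, (Pi.single 1 c : Fin 3 → K) ∈ M ↔ Valued.v c ≤ Valued.v ϖ ^ b) → b ≤ R) :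
    {M : Submodule 𝒪[K] (Fin 3 → K) | IsSelfDualLattice σ ϖ (!![H₂ 0 0, 0, H₂ 0 1; 0, h, 0; H₂ 1 0, 0, H₂ 1 1] : Matrix (Fin 3) (Fin 3) K) M ∧
      mapGL (endoGL (γ₂, u)) M = M}.Finite := by
  classical
  have hϖ0 : ϖ ≠ 0 := fun h0 => by rw [h0, map_zero] at hϖ; exact WithZero.coe_ne_zero hϖ.symm
  have hϖ1 : Valued.v ϖ ≤ 1 := by rw [hϖ, ← WithZero.exp_zero]; exact WithZero.exp_le_exp.2 (by norm_num)
  have hvϖ0 : Valued.v ϖ ≠ 0 := (Valuation.ne_zero_iff _).2 hϖ0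
  have hab : Valued.v (ϖ ^ R) ≤ Valued.v (ϖ ^ R)⁻¹ := by
    rw [map_inv₀, map_pow]
    have hle : Valued.v ϖ ^ R ≤ 1 := pow_le_one' hϖ1 R
    exact hle.trans ((one_le_inv₀ (zero_lt_iff.2 (pow_ne_zero _ hvϖ0))).2 hle)
  -- `A ≤ c⁻¹·A` for `|c| ≤ 1`
  have hup : ∀ {c : K} (hc0 : c ≠ 0) (_hc : Valued.v c ≤ 1) (A : Submodule 𝒪[K] (Fin 3 → K)), A ≤ scaleLattice c⁻¹ A := fun {c} hc0 hc A x hx => by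
    rw [mem_scaleLattice_iff (inv_ne_zero hc0), inv_inv]
    exact A.smul_mem (⟨c, hc⟩ : 𝒪[K]) hx
  -- the covering family, indexed by the finite `W`-set
  let I : Submodule 𝒪[K] (Fin 2 → K) → Set (Submodule 𝒪[K] (Fin 3 → K)) := fun B =>
    {M | ∃ g₂ : GL (Fin 2) K, B = latt (g₂ : Matrix (Fin 2) (Fin 2) K) ∧
      mapGL (endoGL (g₂, (1 : GL (Fin 1) K))) (scaleLattice (ϖ ^ R) (stdLattice K 3)) ≤ M ∧
      M ≤ mapGL (endoGL (g₂, (1 : GL (Fin 1) K))) (scaleLattice (ϖ ^ R)⁻¹ (stdLattice K 3))}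
  have hIfin : ∀ B ∈ {B : Submodule 𝒪[K] (Fin 2 → K) | IsSelfDualLattice σ ϖ H₂ B ∧ mapGL γ₂ B = B}, (I B).Finite := by
    rintro B ⟨⟨gB, hgB, -⟩, -⟩
    refine (finite_setOf_mapGL_scaleLattice_le_and_le hϖ (pow_ne_zero R hϖ0) hab (endoGL (gB, (1 : GL (Fin 1) K)))).subset ?_
    rintro M ⟨g₂, hg₂, hlo, hhi⟩
    have hlatt : latt ((endoGL (g₂, (1 : GL (Fin 1) K)) : GL (Fin 3) K) : Matrix (Fin 3) (Fin 3) K) = latt ((endoGL (gB, (1 : GL (Fin 1) K)) : GL (Fin 3) K) : Matrix (Fin 3) (Fin 3) K) :=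
      (latt_endoGL_one_eq_iff g₂ gB).2 (by rw [← hg₂, hgB])
    have hmap : ∀ c : K, mapGL (endoGL (g₂, (1 : GL (Fin 1) K))) (scaleLattice c (stdLattice K 3)) = mapGL (endoGL (gB, (1 : GL (Fin 1) K))) (scaleLattice c (stdLattice K 3)) := fun c => by
      rw [mapGL_scaleLattice_stdLattice, mapGL_scaleLattice_stdLattice, hlatt]
    exact ⟨by rw [← hmap]; exact hlo, by rw [← hmap]; exact hhi⟩
  refine (hWfin.biUnion hIfin).subset ?_
  rintro M ⟨hM, hfix⟩
  -- tube coordinate, axis vertex, the `W`-lattice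
  obtain ⟨b, hb, -, -⟩ := exists_tubeCoordinate σ hvσ hϖ hH₂ hh hM
  obtain ⟨g₂, hSD₂, hA, -⟩ := exists_axisVertex_eq_latt_endoGL σ hσ hvσ hϖ hH₂ hH₂σ hh hhσ hM hb
  have hfixA := (mapGL_axisVertex_eq_of_mapGL_eq hϖ hb γ₂ u hfix).2
  rw [← hA] at hfixA
  have hB : mapGL γ₂ (latt (g₂ : Matrix (Fin 2) (Fin 2) K)) = latt (g₂ : Matrix (Fin 2) (Fin 2) K) := ((mapGL_endoGL_latt_endoGL_eq_iff g₂ γ₂ u).1 hfixA).1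
  have hbR : b ≤ R := htube M hM hfix b hb
  refine Set.mem_biUnion (x := latt (g₂ : Matrix (Fin 2) (Fin 2) K)) ⟨hSD₂, hB⟩ ⟨g₂, rfl, ?_, ?_⟩
  · -- `ϖ^R·A ≤ ϖ^b·A ≤ M`
    rw [mapGL_scaleLattice_stdLattice, hA, show R = (R - b) + b by omega, pow_add, ← scaleLattice_scaleLattice]
    exact (scaleLattice_le_self_of_v_le_one (by rw [map_pow]; exact pow_le_one' hϖ1 _) _).trans (scaleLattice_axisVertex_le hϖ hb)
  · -- `M ≤ ϖ^{−b}·A ≤ ϖ^{−R}·A`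
    rw [mapGL_scaleLattice_stdLattice, hA, show R = b + (R - b) by omega, pow_add, mul_inv, ← scaleLattice_scaleLattice]
    exact (le_scaleLattice_inv_pow_axisVertex hϖ0 M b).trans
      (scaleLattice_mono _ (hup (pow_ne_zero _ hϖ0) (by rw [map_pow]; exact pow_le_one' hϖ1 _) _))

/-! ## §2 From fixed self-dual lattices to the fixed vertex set of the tree -/

/-- **FINITELY MANY FIXED SELF-DUAL VERTICES ⇒ FINITE FIXED SET** (any `H`): if the lattice graph is a tree whose vertex types alternate along edges and whose stars are finite,
an automorphism `γ` with finitely many fixed SELF-DUAL vertices has a finite fixed set — a fixed non-self-dual vertex is adjacent to a fixed self-dual one (its rooted parent, ★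
`parentClosed_fixedPoints`), unless the fixed set is a single vertex. [cite: Serre1980Trees, I.2.3, I.6.4] [cite: BruhatTits1972, §10] -/
theorem finite_setOf_latticeGraphIso_eq_of_selfDual_finite {σ : K →+* K} {ϖ : K} {H : Matrix (Fin 3) (Fin 3) K}
    (hT : (latticeGraph σ ϖ H).IsTree)
    (halt : ∀ v w, (latticeGraph σ ϖ H).Adj v w → (IsSelfDualLattice σ ϖ H v.1 ↔ ¬ IsSelfDualLattice σ ϖ H w.1))
    (hloc : ∀ v, ((latticeGraph σ ϖ H).neighborSet v).Finite) (γ : unitaryGroupOfForm σ H)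
    (hSDfin : {v : {M : Submodule 𝒪[K] (Fin 3 → K) // IsVertex σ ϖ H M} | IsSelfDualLattice σ ϖ H v.1 ∧ latticeGraphIso σ ϖ H γ v = v}.Finite) :
    {v : {M : Submodule 𝒪[K] (Fin 3 → K) // IsVertex σ ϖ H M} | latticeGraphIso σ ϖ H γ v = v}.Finite := by
  classical
  by_cases hex : ∃ w : {M : Submodule 𝒪[K] (Fin 3 → K) // IsVertex σ ϖ H M}, IsSelfDualLattice σ ϖ H w.1 ∧ latticeGraphIso σ ϖ H γ w = w
  · obtain ⟨w₀, hw₀, hw₀fix⟩ := hex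
    obtain ⟨P, hP1, -, -, -⟩ := exists_rooted_parent hT w₀
    have hpc := parentClosed_fixedPoints hT w₀ (latticeGraphIso σ ϖ H γ) hw₀fix
    refine (hSDfin.union (hSDfin.biUnion fun w _ => hloc w)).subset fun v hv => ?_
    by_cases hvSD : IsSelfDualLattice σ ϖ H v.1
    · exact Or.inl ⟨hvSD, hv⟩
    · have hne : v ≠ w₀ := fun h => hvSD (h ▸ hw₀)
      obtain ⟨hadj, hdist⟩ := hP1 v hne
      have hPfix : latticeGraphIso σ ϖ H γ (P v) = P v := hpc v hv hne (P v) hadj hdist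
      have hPSD : IsSelfDualLattice σ ϖ H (P v).1 := Classical.not_not.1 fun hn => hvSD ((halt v (P v) hadj).2 hn)
      exact Or.inr (Set.mem_biUnion (x := P v) ⟨hPSD, hPfix⟩ hadj.symm)
  · push Not at hex
    refine Set.Subsingleton.finite fun v hv v' hv' => ?_
    by_contra hne
    obtain ⟨P, hP1, -, -, -⟩ := exists_rooted_parent hT v
    have hpc := parentClosed_fixedPoints hT v (latticeGraphIso σ ϖ H γ) hv
    obtain ⟨hadj, hdist⟩ := hP1 v' (Ne.symm hne)
    have hPfix : latticeGraphIso σ ϖ H γ (P v') = P v' := hpc v' hv' (Ne.symm hne) (P v') hadj hdist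
    have hPSD : IsSelfDualLattice σ ϖ H (P v').1 := Classical.not_not.1 fun hn => (hex v' · hv') ((halt v' (P v') hadj).2 hn)
    exact hex (P v') hPSD hPfix

set_option maxHeartbeats 800000 in
-- budget only: statement-heavy block tokens.
/-- **THM B — (z6) «FIX-FINITE, BLOCK LITERAL»**: for `H = ι-shape(H₂, h)` and `γ ∈ U(σ, H)` with matrix `ι(γ₂, u)`, the fixed vertex set `{v ∣ γ·v = v}` of the lattice
graph is FINITE, given the tree, alternation and local finiteness of the graph, finitely many `γ₂`-fixed self-dual `W`-lattices (`hWfin`) and a tube bound (`htube`) — the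
`hFfin` input of the route-B head `strataCount_J₀_block` at a type-(2) literal. [cite: BruhatTits1972, §10] [cite: Kottwitz1986, §3] [cite: Serre1980Trees, I.6.4, II.1.1] -/
theorem finite_setOf_latticeGraphIso_endoGL_eq [IsPrincipalIdealRing 𝒪[K]] [Finite 𝓀[K]] (σ : K →+* K) (hσ : ∀ a, σ (σ a) = a)
    (hvσ : ∀ a, Valued.v (σ a) = Valued.v a) {ϖ : K} (hϖ : Valued.v ϖ = WithZero.exp (-1 : ℤ))
    {H₂ : Matrix (Fin 2) (Fin 2) K} (hH₂ : IsUnit H₂.det) (hH₂σ : (H₂.map σ)ᵀ = H₂) {h : K} (hh : Valued.v h = 1) (hhσ : σ h = h)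
    {H : Matrix (Fin 3) (Fin 3) K} (hH : H = !![H₂ 0 0, 0, H₂ 0 1; 0, h, 0; H₂ 1 0, 0, H₂ 1 1])
    (hT : (latticeGraph σ ϖ H).IsTree)
    (halt : ∀ v w, (latticeGraph σ ϖ H).Adj v w → (IsSelfDualLattice σ ϖ H v.1 ↔ ¬ IsSelfDualLattice σ ϖ H w.1))
    (hloc : ∀ v, ((latticeGraph σ ϖ H).neighborSet v).Finite)
    (γ : unitaryGroupOfForm σ H) (γ₂ : GL (Fin 2) K) (u : GL (Fin 1) K) (hγ : (γ : GL (Fin 3) K) = endoGL (γ₂, u))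
    (hWfin : {B : Submodule 𝒪[K] (Fin 2 → K) | IsSelfDualLattice σ ϖ H₂ B ∧ mapGL γ₂ B = B}.Finite) (R : ℕ)
    (htube : ∀ M : Submodule 𝒪[K] (Fin 3 → K), IsSelfDualLattice σ ϖ (!![H₂ 0 0, 0, H₂ 0 1; 0, h, 0; H₂ 1 0, 0, H₂ 1 1] : Matrix (Fin 3) (Fin 3) K) M →
      mapGL (endoGL (γ₂, u)) M = M → ∀ b : ℕ, (∀ c : K, (Pi.single 1 c : Fin 3 → K) ∈ M ↔ Valued.v c ≤ Valued.v ϖ ^ b) → b ≤ R) :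
    {v : {M : Submodule 𝒪[K] (Fin 3 → K) // IsVertex σ ϖ H M} | latticeGraphIso σ ϖ H γ v = v}.Finite := by
  subst hH
  refine finite_setOf_latticeGraphIso_eq_of_selfDual_finite hT halt hloc γ ?_
  have hA := finite_setOf_selfDual_mapGL_endoGL_eq σ hσ hvσ hϖ hH₂ hH₂σ hh hhσ γ₂ u hWfin R htube
  refine (hA.preimage (Subtype.val_injective.injOn)).subset ?_
  rintro v ⟨hv, hfix⟩
  refine ⟨hv, ?_⟩
  have h := congrArg Subtype.val hfix
  rw [latticeGraphIso_apply_coe, hγ] at h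
  exact h

end Literature.NumberTheory.Automorphic.UnitaryLatticeTree

end
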